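import Mathlib
import Literature.RingTheory.KrullDimension.AffineDimension
import Literature.AlgebraicGeometry.Resolution.RegularLocalRingsProofs

/-!
# Crux `PicoverLocalModel` (stmt-ResolutionOfSingularities-0557), line `SketchIdeator3`
# (giraud-cossart-normal-form) — the TRANSVERSAL exit of the endgame atlas

Registered helper of the endgame stub `stub_endgameAtlas`: at a transversal point of the regular
modification the local radicand is an element `u` of the regular local ring `O = 𝒪_{W,w}` of
characteristic `p` with `u ≡ c^p (mod 𝔪)` and `v := u - c^p ∈ 𝔪 ∖ 𝔪²`. Then the purely
inseparable cover `O' := O[T]/(T^p - u)` is again a REGULAR LOCAL ring: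

* put `τ := t - c ∈ O'` (`t` the class of `T`); in characteristic `p`,
  `τ^p = t^p - c^p = u - c^p = v` (`sub_pow_char` in `O[T]`);
* the residue map `O' → κ = O/𝔪`, `t ↦ c̄` (well defined as `c̄^p = ū`) is surjective with kernel
  `𝔐 := 𝔪O' + (τ)` (for `g ∈ O[T]`: `g ≡ g(c) (mod (T - c))`), so `𝔐` is a maximal ideal;
* every maximal ideal `N` of the integral extension `O'` lies over `𝔪`, so `𝔪O' ⊆ N`, and
  `τ^p = v ∈ 𝔪O' ⊆ N` forces `τ ∈ N`; hence `𝔐 ⊆ N`, `N = 𝔐`: `O'` is local with maximal ideal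
  `𝔐`;
* `v ∉ 𝔪²` extends to a minimal system of generators `v, y₂, …, y_d` of `𝔪` (`d = emb dim O =
  dim O`, `Literature.AlgebraicGeometry.Resolution.exists_span_insert_eq_maximalIdeal`), and
  `𝔐 = (v, y₂, …, y_d, τ) = (τ, y₂, …, y_d)` since `v = τ^p`: at most `d` generators, while
  `dim O' = dim O` (`O'` is finite free over `O`,
  `Literature.RingTheory.KrullDimension.ringKrullDim_eq_of_isIntegral`). Hence `O'` is regular.

Contents: `root_sub_of_pow_eq` (`τ^p = v`), `isLocalRing_adjoinRoot_of_transversal` (locality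
with maximal ideal `𝔪O' + (τ)`; only `u - c^p ∈ 𝔪` is needed),
`isRegularLocalRing_adjoinRoot_of_transversal` (the registered helper). No statement item is
restated.
-/

-- The namespace mirrors the crux/line layout (`…Theorems.PicoverLocalModel.TransversalExit`) on purpose.
set_option linter.dupNamespace false

noncomputable section

namespace Summit.ResolutionOfSingularities.ResolutionOfSingularities.Theorems.PicoverLocalModel.TransversalExit

open Polynomial IsLocalRing Literature.AlgebraicGeometry.Resolution

/-- **`τ^p = v`.** In `O' = O[T]/(T^p - u)` over a ring `O` of prime characteristic `p`, the
element `τ := t - c` satisfies `τ^p = u - c^p` (freshman's dream in `O[T]`: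
`(T - c)^p = T^p - c^p = (T^p - u) + (u - c^p)`). [folklore] -/
theorem root_sub_of_pow_eq {O : Type*} [CommRing O] (p : ℕ) [Fact p.Prime] [CharP O p]
    (u c : O) :
    (AdjoinRoot.root ((X : O[X]) ^ p - C u) - AdjoinRoot.of ((X : O[X]) ^ p - C u) c) ^ p =
      AdjoinRoot.of ((X : O[X]) ^ p - C u) (u - c ^ p) := by
  calc (AdjoinRoot.root ((X : O[X]) ^ p - C u) - AdjoinRoot.of ((X : O[X]) ^ p - C u) c) ^ p
        = AdjoinRoot.mk ((X : O[X]) ^ p - C u) ((X - C c) ^ p) := by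
          rw [map_pow, map_sub, AdjoinRoot.mk_X, AdjoinRoot.mk_C]
    _ = AdjoinRoot.mk ((X : O[X]) ^ p - C u) (((X : O[X]) ^ p - C u) + C (u - c ^ p)) := by
          congr 1
          rw [sub_pow_char, ← C_pow, C_sub]
          ring
    _ = AdjoinRoot.of ((X : O[X]) ^ p - C u) (u - c ^ p) := by
          rw [map_add, AdjoinRoot.mk_self, zero_add, AdjoinRoot.mk_C]

/-- **A transversal cover of a local ring is local.** Let `(O, 𝔪, κ)` be a local ring of prime
characteristic `p` and `u, c ∈ O` with `u - c^p ∈ 𝔪` (the residue of `u` is the `p`-th power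
`c̄^p`). Then `O' = O[T]/(T^p - u)` is a local ring whose maximal ideal is `𝔪O' + (t - c)`: this
ideal is the kernel of the surjection `O' → κ`, `t ↦ c̄`, and every maximal ideal of the integral
extension `O'` lies over `𝔪` and contains `t - c` (as `(t - c)^p = u - c^p ∈ 𝔪O'`). [folklore] -/
theorem isLocalRing_adjoinRoot_of_transversal {O : Type*} [CommRing O] [IsLocalRing O] (p : ℕ)
    [Fact p.Prime] [CharP O p] {u c : O} (h : u - c ^ p ∈ maximalIdeal O) :
    ∃ _ : IsLocalRing (AdjoinRoot ((X : O[X]) ^ p - C u)),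
      maximalIdeal (AdjoinRoot ((X : O[X]) ^ p - C u)) =
        (maximalIdeal O).map (AdjoinRoot.of ((X : O[X]) ^ p - C u)) ⊔
          Ideal.span {AdjoinRoot.root ((X : O[X]) ^ p - C u) -
            AdjoinRoot.of ((X : O[X]) ^ p - C u) c} := by
  have hp : p.Prime := Fact.out
  have hτp := root_sub_of_pow_eq p u c
  set f : O[X] := X ^ p - C u with hf_def
  have hf : f.Monic := monic_X_pow_sub_C u hp.ne_zero
  haveI : Module.Finite O (AdjoinRoot f) := hf.finite_adjoinRoot
  haveI : Algebra.IsIntegral O (AdjoinRoot f) := inferInstance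
  -- the residue map `φ : O' → κ`, `t ↦ c̄`
  have hφ : f.eval₂ (residue O) (residue O c) = 0 := by
    rw [eval₂_hom, residue_eq_zero_iff, hf_def, eval_sub, eval_pow, eval_X, eval_C, ← neg_sub]
    exact (maximalIdeal O).neg_mem h
  set φ : AdjoinRoot f →+* ResidueField O := AdjoinRoot.lift (residue O) (residue O c) hφ
    with hφ_def
  have hsurj : Function.Surjective φ := fun x => by
    obtain ⟨a, rfl⟩ := residue_surjective x
    exact ⟨AdjoinRoot.of f a, AdjoinRoot.lift_of hφ⟩
  -- its kernel is `𝔪O' + (τ)`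
  have hker : RingHom.ker φ =
      (maximalIdeal O).map (AdjoinRoot.of f) ⊔ Ideal.span {AdjoinRoot.root f - AdjoinRoot.of f c} := by
    apply le_antisymm
    · intro x hx
      obtain ⟨g, rfl⟩ := AdjoinRoot.mk_surjective x
      rw [RingHom.mem_ker, hφ_def, AdjoinRoot.lift_mk, eval₂_hom, residue_eq_zero_iff] at hx
      -- `g = g(c) + (T - c) q`
      obtain ⟨q, hq⟩ := X_sub_C_dvd_sub_C_eval (a := c) (p := g)
      have hg : AdjoinRoot.mk f g = AdjoinRoot.of f (g.eval c) +
          (AdjoinRoot.root f - AdjoinRoot.of f c) * AdjoinRoot.mk f q := by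
        have := congrArg (AdjoinRoot.mk f) hq
        rw [map_sub, map_mul, map_sub, AdjoinRoot.mk_X, AdjoinRoot.mk_C, AdjoinRoot.mk_C] at this
        rw [← this]
        ring
      rw [hg]
      exact Ideal.add_mem _ (Ideal.mem_sup_left (Ideal.mem_map_of_mem _ hx))
        (Ideal.mem_sup_right (Ideal.mul_mem_right _ _ (Ideal.mem_span_singleton_self _)))
    · refine sup_le ?_ ?_
      · rw [Ideal.map_le_iff_le_comap]
        intro m hm
        rw [Ideal.mem_comap, RingHom.mem_ker, hφ_def, AdjoinRoot.lift_of, residue_eq_zero_iff]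
        exact hm
      · rw [Ideal.span_singleton_le_iff_mem, RingHom.mem_ker, map_sub, hφ_def, AdjoinRoot.lift_root,
          AdjoinRoot.lift_of, sub_self]
  have hM : (RingHom.ker φ).IsMaximal := RingHom.ker_isMaximal_of_surjective φ hsurj
  haveI : IsLocalRing (AdjoinRoot f) := by
    refine IsLocalRing.of_unique_max_ideal ⟨_, hM, fun N hN => ?_⟩
    have h1 : N.comap (algebraMap O (AdjoinRoot f)) = maximalIdeal O :=
      IsLocalRing.eq_maximalIdeal (Ideal.isMaximal_comap_of_isIntegral_of_isMaximal N)
    have h2 : (maximalIdeal O).map (AdjoinRoot.of f) ≤ N := by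
      rw [← h1, AdjoinRoot.algebraMap_eq]
      exact Ideal.map_comap_le
    have h3 : AdjoinRoot.root f - AdjoinRoot.of f c ∈ N := by
      refine hN.isPrime.mem_of_pow_mem p ?_
      rw [hτp]
      exact h2 (Ideal.mem_map_of_mem _ h)
    refine (hM.eq_of_le hN.ne_top ?_).symm
    rw [hker]
    exact sup_le h2 ((Ideal.span_singleton_le_iff_mem _).mpr h3)
  exact ⟨inferInstance, by rw [← hker]; exact (IsLocalRing.eq_maximalIdeal hM).symm⟩

/-- **Transversal exit of the endgame atlas.** Let `(O, 𝔪)` be a regular local ring of prime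
characteristic `p` and `u, c ∈ O` with `v := u - c^p ∈ 𝔪 ∖ 𝔪²`. Then the purely inseparable
`p`-cyclic cover `O' = O[T]/(T^p - u)` is a regular local ring: it is local with maximal ideal
`𝔐 = 𝔪O' + (τ)`, `τ = t - c`, `τ^p = v`; extending `v` to a minimal system of generators
`v, y₂, …, y_d` of `𝔪` (`d = dim O`) gives `𝔐 = (τ, y₂, …, y_d)`, at most `d = dim O'`
generators (`O'` is finite free over `O`). [folklore] -/
theorem isRegularLocalRing_adjoinRoot_of_transversal : ∀ {O : Type*} [CommRing O] [IsRegularLocalRing O] (p : ℕ) [Fact p.Prime] [CharP O p] (u c : O), u - c ^ p ∈ IsLocalRing.maximalIdeal O → u - c ^ p ∉ IsLocalRing.maximalIdeal O ^ 2 → IsRegularLocalRing (AdjoinRoot ((Polynomial.X : Polynomial O) ^ p - Polynomial.C u)) := by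
  intro O _ _ p _ _ u c hv hv2
  have hp : p.Prime := Fact.out
  have hτp := root_sub_of_pow_eq p u c
  obtain ⟨_, hmax⟩ := isLocalRing_adjoinRoot_of_transversal p (u := u) (c := c) hv
  set f : O[X] := X ^ p - C u with hf_def
  have hf : f.Monic := monic_X_pow_sub_C u hp.ne_zero
  haveI : Module.Finite O (AdjoinRoot f) := hf.finite_adjoinRoot
  haveI : Module.Free O (AdjoinRoot f) := hf.free_adjoinRoot
  haveI : Algebra.IsIntegral O (AdjoinRoot f) := inferInstance
  haveI : Nontrivial (AdjoinRoot f) := by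
    refine Ideal.Quotient.nontrivial_iff.mpr ?_
    rw [Ne, Ideal.span_singleton_eq_top, hf.isUnit_iff]
    intro h1
    have h := congrArg natDegree h1
    rw [hf_def, natDegree_X_pow_sub_C, natDegree_one] at h
    exact hp.ne_zero h
  have hinj : Function.Injective (algebraMap O (AdjoinRoot f)) :=
    FaithfulSMul.algebraMap_injective O _
  haveI : IsNoetherianRing (AdjoinRoot f) := inferInstance
  refine IsRegularLocalRing.of_spanFinrank_maximalIdeal_le _ ?_
  have hdim : ringKrullDim (AdjoinRoot f) = ringKrullDim O :=
    (Literature.RingTheory.KrullDimension.ringKrullDim_eq_of_isIntegral hinj).symm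
  -- a minimal system of generators `v, s` of `𝔪`
  obtain ⟨s, hsfin, hscard, hspan⟩ := exists_span_insert_eq_maximalIdeal hv hv2
  -- `𝔐 = (τ, s)`
  have key : maximalIdeal (AdjoinRoot f) =
      Ideal.span (insert (AdjoinRoot.root f - AdjoinRoot.of f c) (AdjoinRoot.of f '' s)) := by
    rw [hmax, ← hspan, Ideal.map_span, Set.image_insert_eq]
    apply le_antisymm
    · refine sup_le ?_ ?_
      · rw [Ideal.span_le]
        rintro x (rfl | hx)
        · rw [← hτp]
          exact Ideal.pow_mem_of_mem _ (Ideal.subset_span (Set.mem_insert _ _)) _ hp.pos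
        · exact Ideal.subset_span (Set.mem_insert_of_mem _ hx)
      · rw [Ideal.span_singleton_le_iff_mem]
        exact Ideal.subset_span (Set.mem_insert _ _)
    · rw [Ideal.span_le]
      rintro x (rfl | hx)
      · exact Ideal.mem_sup_right (Ideal.mem_span_singleton_self _)
      · exact Ideal.mem_sup_left (Ideal.subset_span (Set.mem_insert_of_mem _ hx))
  rw [key, hdim, ← IsRegularLocalRing.spanFinrank_maximalIdeal]
  have h1 := Submodule.spanFinrank_span_le_ncard_of_finite (R := AdjoinRoot f)
    ((hsfin.image (AdjoinRoot.of f)).insert (AdjoinRoot.root f - AdjoinRoot.of f c))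
  have h2 := Set.ncard_insert_le (AdjoinRoot.root f - AdjoinRoot.of f c) (AdjoinRoot.of f '' s)
  have h3 := Set.ncard_image_le (f := AdjoinRoot.of f) hsfin
  exact_mod_cast h1.trans (h2.trans (by omega))

end Summit.ResolutionOfSingularities.ResolutionOfSingularities.Theorems.PicoverLocalModel.TransversalExit

end
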